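import Mathlib
import HarnessLib
import Summits.Ventures.LatticeQCDFlow.Exactness.LeapfrogHMCDoeblin
import Summits.Ventures.LatticeQCDFlow.Exactness.SU2ExpChartMinorisation
import Summits.Ventures.LatticeQCDFlow.Exactness.StdGaussianRadial

/-!
# Single-step leapfrog HMC on `SU(2)` lattice gauge fields, as the engine runs it: the kernel and its exactness

HONEST FRAMING: exact (Metropolis-corrected) sampling algorithms for lattice gauge theory;
figures of merit are autocorrelation/cost numbers at stated couplings and volumes; no
continuum-physics claim.

Venture `LatticeQCDFlow` (cell pub-lqcd), topic `Exactness`, FANOUT row 9 (eng-latcore, the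
engine `latflow.core.hmc.HMC(f, β, 'leapfrog')` on `SU(2)`, `trajectory(τ, nstep = 1)`).  NEW
WORK of the cell over Mathlib and the tree (`LeapfrogHMCDoeblin.lean`, `SU2ExpChartMinorisation.lean`,
`MomentumRefresh.hmc_config_exact`, `SplittingIntegrator.lean` / `SplittingWords.lean`,
`StdGaussianRadial.lintegral_prod_pi`); nothing here is cited as a fact.  Printed counterparts,
named only: Duane–Kennedy–Pendleton–Roweth 1987, Kennedy–Pendleton / Gottlieb et al. 1987 (the
gauge-link leapfrog `U ← e^{εP} U`).

THE ENGINE'S UPDATE, TYPED CONCRETELY (this file = part 1: the objects and exactness; part 2,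
`SU2LeapfrogHMCErgodic.lean` = Doeblin and uniform ergodicity).  Links `U : ι → SU(2)` (any finite
link set `ι`), momenta `P_l = i p_l·σ ∈ 𝔰𝔲(2)` in Pauli coordinates `p : ι → ℝ³`
(`random_algebra` / `lc_momenta` draw `p_l ∼ N(0, ¼·1₃)`, density `∝ e^{−2|p_l|²} = e^{tr P_l²}`; here
any `κ > 0`, `T_κ(p) = κ Σ_l |p_l|²`), ONE P-first leapfrog step `P ← P + g(U)`, `U_l ← exp(iε p_l·σ) U_l`,
`P ← P + g(U)` with ANY measurable momentum increment `g` (in the engine `−½ε ∂S`; its accuracy is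
irrelevant to everything below), the momentum flip, the Metropolis test on `H = S(U) + T_κ(p)`,
forget the momenta:

* `su2ExpDrift` (`su2ExpDrift_neg`: `e_ε(−p) = e_ε(p)⁻¹`, from `expPauli_neg`), `su2Kinetic`,
  `su2MomentumWeight` / `su2MomentumLaw` = `Z⁻¹ e^{−T_κ} dp` with **`su2MomentumWeight_univ`**:
  `Z = ((π/κ)^{3/2})^{|ι|}` (Mathlib's Gaussian integral on `ℝ³`, Tonelli over the links), hence
  `0 < Z < ∞` and `su2MomentumLaw` is a probability law;
* `su2LeapfrogProposal ε g = flip ∘ K(g) D(e_ε) K(g)` — measurable, an involution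
  (`involutive_su2LeapfrogProposal`), Liouville for `Haar^{⊗ι} ⊗ Lebesgue`
  (`measurePreserving_su2LeapfrogProposal`; `isNegInvariant_volume_momenta`);
* **`su2LeapfrogHMC ε κ hg S`** — THE CONFIGURATION KERNEL, literally the tree's
  `refreshUpdate (involMH (su2LeapfrogProposal ε g) _ (S + T_κ)) (su2MomentumLaw κ)`;
  `su2GibbsLaw S = Z_S⁻¹ e^{−S} · Haar^{⊗ι}`;
* **`su2LeapfrogHMC_invariant`** — EXACTNESS: the kernel leaves `e^{−S} · Haar^{⊗ι}` invariant for
  every measurable `S`, every `ε`, every `κ > 0`, every measurable `g` (`hmc_config_exact`).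

NOT CLAIMED here: anything about rates or ergodicity (part 2); `nstep ≥ 2` / OMF words (exact by
`SplittingWords.lean`, not re-instantiated); `SU(N ≥ 3)`; floating point; the identification
`κ = 2` with the engine's matrix momenta is the dictionary of `GaussianProjection.lean` /
`SUNGeneratorSum.lean`, not re-derived.
-/

noncomputable section

namespace Summit.Ventures.LatticeQCDFlow.Exactness

open MeasureTheory ProbabilityTheory ProbabilityTheory.Kernel Set Metric
open Literature.MathematicalPhysics.QuantumFieldTheory (haarProbability)
open Literature.MathematicalPhysics.QuantumFieldTheory.Balaban1983to89.B10Eq18SigmaSU2Haar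
  (expPauli measurable_expPauli continuous_expPauli)
open scoped ENNReal

variable {ι : Type*}

/-! ## §1 The engine's single-step leapfrog HMC on `SU(2)^ι`, and its exactness -/

section Defs

/-- **The link drift factors** `e_ε(p)_l = exp(iε p_l·σ) ∈ SU(2)` (the engine's `U ← expm(ε P) U`
with `P_l = i p_l·σ` in Pauli coordinates). -/
def su2ExpDrift (ε : ℝ) (p : ι → EuclideanSpace ℝ (Fin 3)) : ι → Matrix.specialUnitaryGroup (Fin 2) ℂ :=
  fun l => expPauli (ε • p l)

/-- The drift factor at a link. -/
@[simp] theorem su2ExpDrift_apply (ε : ℝ) (p : ι → EuclideanSpace ℝ (Fin 3)) (l : ι) :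
    su2ExpDrift ε p l = expPauli (ε • p l) := rfl

/-- Time reversal of the drift: `e_ε(−p) = e_ε(p)⁻¹`. -/
theorem su2ExpDrift_neg (ε : ℝ) (p : ι → EuclideanSpace ℝ (Fin 3)) :
    su2ExpDrift ε (-p) = (su2ExpDrift ε p)⁻¹ := by
  funext l
  simp only [su2ExpDrift, Pi.neg_apply, Pi.inv_apply, smul_neg]
  exact expPauli_neg _

/-- The drift factors depend measurably on the momenta. -/
theorem measurable_su2ExpDrift (ε : ℝ) :
    Measurable (su2ExpDrift (ι := ι) ε) :=
  measurable_pi_lambda _ fun l => measurable_expPauli.comp ((measurable_pi_apply l).const_smul ε)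

variable [Fintype ι]

/-- **The kinetic term** `T_κ(p) = κ Σ_l |p_l|²` (the engine's `−tr P² = 2|p|²`, `κ = 2`). -/
def su2Kinetic (κ : ℝ) (p : ι → EuclideanSpace ℝ (Fin 3)) : ℝ := κ * ∑ l, ‖p l‖ ^ 2

/-- The kinetic term is continuous. -/
theorem continuous_su2Kinetic (κ : ℝ) : Continuous (su2Kinetic (ι := ι) κ) :=
  continuous_const.mul (continuous_finsetSum _ fun l _ => ((continuous_apply l).norm).pow 2)

/-- The kinetic term is measurable. -/
theorem measurable_su2Kinetic (κ : ℝ) : Measurable (su2Kinetic (ι := ι) κ) :=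
  (continuous_su2Kinetic κ).measurable

/-- The kinetic term is non-negative for `κ ≥ 0`. -/
theorem su2Kinetic_nonneg {κ : ℝ} (hκ : 0 ≤ κ) (p : ι → EuclideanSpace ℝ (Fin 3)) :
    0 ≤ su2Kinetic κ p :=
  mul_nonneg hκ (Finset.sum_nonneg fun _ _ => sq_nonneg _)

/-- The kinetic term is even. -/
theorem su2Kinetic_neg (κ : ℝ) (p : ι → EuclideanSpace ℝ (Fin 3)) :
    su2Kinetic κ (-p) = su2Kinetic κ p := by
  simp [su2Kinetic]

/-- In a box `|p_l| ≤ R` the kinetic term is at most `κ |ι| R²`. -/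
theorem su2Kinetic_le_of_norm_le {κ : ℝ} (hκ : 0 ≤ κ) {R : ℝ} {p : ι → EuclideanSpace ℝ (Fin 3)}
    (hp : ∀ l, ‖p l‖ ≤ R) : su2Kinetic κ p ≤ κ * (Fintype.card ι * R ^ 2) := by
  unfold su2Kinetic
  refine mul_le_mul_of_nonneg_left ?_ hκ
  calc ∑ l, ‖p l‖ ^ 2 ≤ ∑ _l : ι, R ^ 2 :=
        Finset.sum_le_sum fun l _ => pow_le_pow_left₀ (norm_nonneg _) (hp l) 2
    _ = Fintype.card ι * R ^ 2 := by rw [Finset.sum_const, Finset.card_univ, nsmul_eq_mul]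

/-- **The un-normalised momentum weight** `e^{−T_κ(p)} dp` (Lebesgue measure on `(ℝ³)^ι`). -/
def su2MomentumWeight (κ : ℝ) : Measure (ι → EuclideanSpace ℝ (Fin 3)) :=
  volume.withDensity fun p => ENNReal.ofReal (Real.exp (-su2Kinetic κ p))

/-- **The momentum refresh law** `Z⁻¹ e^{−T_κ(p)} dp` (independent centred Gaussians,
`p_l ∼ N(0, (2κ)⁻¹·1₃)`). -/
def su2MomentumLaw (κ : ℝ) : Measure (ι → EuclideanSpace ℝ (Fin 3)) :=
  (su2MomentumWeight (ι := ι) κ univ)⁻¹ • su2MomentumWeight κ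

/-- The one-link Gaussian integral: `∫_{ℝ³} e^{−κ|v|²} dv = (π/κ)^{3/2}` (Mathlib's
`integral_rexp_neg_mul_sq_norm`), as a lower Lebesgue integral. -/
theorem lintegral_exp_neg_mul_sq_norm_three {κ : ℝ} (hκ : 0 < κ) :
    ∫⁻ v : EuclideanSpace ℝ (Fin 3), ENNReal.ofReal (Real.exp (-κ * ‖v‖ ^ 2)) =
      ENNReal.ofReal ((Real.pi / κ) ^ ((3 : ℝ) / 2)) := by
  have hval : ∫ v : EuclideanSpace ℝ (Fin 3), Real.exp (-κ * ‖v‖ ^ 2) = (Real.pi / κ) ^ ((3 : ℝ) / 2) := by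
    rw [GaussianFourier.integral_rexp_neg_mul_sq_norm hκ, finrank_euclideanSpace_fin]
    norm_num
  have hpos : (0 : ℝ) < (Real.pi / κ) ^ ((3 : ℝ) / 2) := by positivity
  have hint : Integrable (fun v : EuclideanSpace ℝ (Fin 3) => Real.exp (-κ * ‖v‖ ^ 2)) := by
    by_contra h
    have h0 := integral_undef h
    rw [hval] at h0
    exact hpos.ne' h0
  rw [← ofReal_integral_eq_lintegral_ofReal hint (Filter.Eventually.of_forall fun v => (Real.exp_pos _).le),
    hval]

/-- **`Z = ((π/κ)^{3/2})^{|ι|}`**: the momentum weight factorises over the links (Tonelli,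
`StdGaussianRadial.lintegral_prod_pi`). -/
theorem su2MomentumWeight_univ {κ : ℝ} (hκ : 0 < κ) :
    su2MomentumWeight (ι := ι) κ univ = ENNReal.ofReal ((Real.pi / κ) ^ ((3 : ℝ) / 2)) ^ Fintype.card ι := by
  have hmeas1 : Measurable fun v : EuclideanSpace ℝ (Fin 3) => ENNReal.ofReal (Real.exp (-κ * ‖v‖ ^ 2)) :=
    (Real.measurable_exp.comp (measurable_const.mul (measurable_norm.pow_const 2))).ennreal_ofReal
  have h1 : ∀ p : ι → EuclideanSpace ℝ (Fin 3), ENNReal.ofReal (Real.exp (-su2Kinetic κ p)) =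
      ∏ l, ENNReal.ofReal (Real.exp (-κ * ‖p l‖ ^ 2)) := by
    intro p
    rw [← ENNReal.ofReal_prod_of_nonneg (fun l _ => (Real.exp_pos _).le), ← Real.exp_sum]
    congr 2
    rw [su2Kinetic, Finset.mul_sum Finset.univ (fun l => ‖p l‖ ^ 2) κ, ← Finset.sum_neg_distrib]
    exact Finset.sum_congr rfl fun l _ => by ring
  rw [su2MomentumWeight, withDensity_apply _ MeasurableSet.univ, Measure.restrict_univ, volume_pi]
  simp_rw [h1]
  rw [lintegral_prod_pi (fun _ : ι => (volume : Measure (EuclideanSpace ℝ (Fin 3)))) (fun _ => hmeas1),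
    Finset.prod_const, Finset.card_univ, lintegral_exp_neg_mul_sq_norm_three hκ]

/-- `Z ≠ 0`. -/
theorem su2MomentumWeight_univ_ne_zero {κ : ℝ} (hκ : 0 < κ) : su2MomentumWeight (ι := ι) κ univ ≠ 0 := by
  rw [su2MomentumWeight_univ hκ]
  refine pow_ne_zero _ ?_
  rw [Ne, ENNReal.ofReal_eq_zero, not_le]
  positivity

/-- `Z ≠ ∞`. -/
theorem su2MomentumWeight_univ_ne_top {κ : ℝ} (hκ : 0 < κ) : su2MomentumWeight (ι := ι) κ univ ≠ ⊤ := by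
  rw [su2MomentumWeight_univ hκ]
  exact ENNReal.pow_ne_top ENNReal.ofReal_ne_top

/-- The momentum refresh law is a probability law. -/
instance isProbabilityMeasure_su2MomentumLaw {κ : ℝ} [hκ : Fact (0 < κ)] :
    IsProbabilityMeasure (su2MomentumLaw (ι := ι) κ) :=
  ⟨by rw [su2MomentumLaw, Measure.smul_apply, smul_eq_mul,
    ENNReal.inv_mul_cancel (su2MomentumWeight_univ_ne_zero hκ.out) (su2MomentumWeight_univ_ne_top hκ.out)]⟩

/-- Lebesgue measure on the momenta is symmetric under `p ↦ −p`. -/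
theorem isNegInvariant_volume_momenta :
    (volume : Measure (ι → EuclideanSpace ℝ (Fin 3))).IsNegInvariant :=
  haveI : (volume : Measure (ι → EuclideanSpace ℝ (Fin 3))).Regular :=
    Measure.Regular.of_sigmaCompactSpace_of_isLocallyFiniteMeasure _
  Measure.IsAddHaarMeasure.isNegInvariant_of_regular _

variable (ε : ℝ) (g : (ι → Matrix.specialUnitaryGroup (Fin 2) ℂ) → ι → EuclideanSpace ℝ (Fin 3))

/-- **The proposal map**: ONE P-first leapfrog step `K(g) D(e_ε) K(g)` followed by the momentum flip
(`g` = the momentum increment of a half kick, in the engine `−½ε ∂S`). -/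
def su2LeapfrogProposal :
    Equiv.Perm ((ι → Matrix.specialUnitaryGroup (Fin 2) ℂ) × (ι → EuclideanSpace ℝ (Fin 3))) :=
  flip * palindromicWord [kick g] (drift (mulDrift (su2ExpDrift ε))) ^ 1

variable {g}

omit [Fintype ι] in
/-- The proposal map is measurable (for measurable `g`). -/
theorem measurable_su2LeapfrogProposal (hg : Measurable g) : Measurable (⇑(su2LeapfrogProposal ε g)) := by
  rw [su2LeapfrogProposal, pow_one, palindromicWord_kick_drift, Equiv.Perm.coe_mul, Equiv.Perm.coe_mul,
    Equiv.Perm.coe_mul]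
  exact measurable_flip.comp ((measurable_kick hg).comp
    ((measurable_drift (measurable_mulDrift (measurable_su2ExpDrift ε))).comp (measurable_kick hg)))

omit [Fintype ι] in
/-- The proposal map is an involution (time reversal of the palindromic word). -/
theorem involutive_su2LeapfrogProposal : Function.Involutive (⇑(su2LeapfrogProposal ε g)) :=
  (palindromicWord_pow_isFlipReversible flip_mul_flip
    (drift_isFlipReversible (mulDrift_reversal (su2ExpDrift_neg ε)))
    (fun A hA => by rw [List.mem_singleton] at hA; subst hA; exact kick_isFlipReversible g) 1).involutive

/-- The proposal map preserves `Haar^{⊗ι} ⊗ Lebesgue` (Liouville). -/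
theorem measurePreserving_su2LeapfrogProposal (hg : Measurable g) :
    MeasurePreserving (⇑(su2LeapfrogProposal ε g))
      ((Measure.pi fun _ : ι => haarProbability (Matrix.specialUnitaryGroup (Fin 2) ℂ)).prod volume)
      ((Measure.pi fun _ : ι => haarProbability (Matrix.specialUnitaryGroup (Fin 2) ℂ)).prod volume) := by
  haveI := isNegInvariant_volume_momenta (ι := ι)
  rw [su2LeapfrogProposal, Equiv.Perm.coe_mul]
  exact measurePreserving_flip.comp (measurePreserving_perm_pow
    (measurePreserving_palindromicWord
      (measurePreserving_drift (measurable_mulDrift (measurable_su2ExpDrift ε))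
        (measurePreserving_mulDrift (su2ExpDrift ε)))
      (fun A hA => by rw [List.mem_singleton] at hA; subst hA; exact measurePreserving_kick hg)) 1)

variable (κ : ℝ)

/-- **THE ENGINE'S CONFIGURATION KERNEL** (`hmc.HMC(f, β, 'leapfrog').trajectory(τ = ε, nstep = 1)`):
refresh `p ∼ Z⁻¹e^{−T_κ}`, one P-first leapfrog step, flip, Metropolis test on `S + T_κ`, forget `p`. -/
def su2LeapfrogHMC (hg : Measurable g) (S : (ι → Matrix.specialUnitaryGroup (Fin 2) ℂ) → ℝ) :
    Kernel (ι → Matrix.specialUnitaryGroup (Fin 2) ℂ) (ι → Matrix.specialUnitaryGroup (Fin 2) ℂ) :=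
  refreshUpdate
    (involMH (⇑(su2LeapfrogProposal ε g)) (measurable_su2LeapfrogProposal ε hg)
      fun z => S z.1 + su2Kinetic κ z.2)
    (su2MomentumLaw κ)

/-- **The Gibbs law** `π_S = Z_S⁻¹ e^{−S} · Haar^{⊗ι}` (for the Wilson action: the torus Wilson measure). -/
def su2GibbsLaw (S : (ι → Matrix.specialUnitaryGroup (Fin 2) ℂ) → ℝ) :
    Measure (ι → Matrix.specialUnitaryGroup (Fin 2) ℂ) :=
  (((Measure.pi fun _ : ι => haarProbability (Matrix.specialUnitaryGroup (Fin 2) ℂ)).withDensity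
      fun u => ENNReal.ofReal (Real.exp (-S u))) univ)⁻¹ •
    (Measure.pi fun _ : ι => haarProbability (Matrix.specialUnitaryGroup (Fin 2) ℂ)).withDensity
      fun u => ENNReal.ofReal (Real.exp (-S u))

variable {ε κ}

/-- **Exactness**: the kernel leaves `e^{−S} · Haar^{⊗ι}` invariant (`hmc_config_exact` with the
Liouville and time-reversal facts above), for every measurable `S`, every `ε`, every `κ > 0`. -/
theorem su2LeapfrogHMC_invariant (hκ : 0 < κ) (hg : Measurable g)
    {S : (ι → Matrix.specialUnitaryGroup (Fin 2) ℂ) → ℝ} (hS : Measurable S) :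
    Invariant (su2LeapfrogHMC ε κ hg S)
      ((Measure.pi fun _ : ι => haarProbability (Matrix.specialUnitaryGroup (Fin 2) ℂ)).withDensity
        fun u => ENNReal.ofReal (Real.exp (-S u))) :=
  hmc_config_exact (vol := Measure.pi fun _ : ι => haarProbability (Matrix.specialUnitaryGroup (Fin 2) ℂ))
    (volP := volume) (hΦ := measurable_su2LeapfrogProposal ε hg) hS (measurable_su2Kinetic κ)
    (involutive_su2LeapfrogProposal ε) (measurePreserving_su2LeapfrogProposal ε hg)
    (su2MomentumWeight_univ_ne_zero hκ) (su2MomentumWeight_univ_ne_top hκ)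

end Defs

end Summit.Ventures.LatticeQCDFlow.Exactness
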